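import Summits.Ventures.CertifiedArithmetic.LowPrec.GemmThetaLawGenMixCData

/-!
# E3M2×E2M3 law check, part 1/14: `Q` (sign +), `Q` (sign −)

HONEST FRAMING (venture CertifiedArithmetic / cell `pub-lowprec`, seat gemm, gen 13): certified
error envelopes and provably optimal rounding/accumulation schemes for low-precision formats under
stated cost models; every table by two implementations; no hardware or vendor claims.

Part 1/14 of the per-level kernel check of `e3m2e2m3Law.lawCheck` (see
`GemmThetaLawGenMixCData.lean`): `Q` (sign +), `Q` (sign −) (2395 + 2395 classes; a level above
2400 classes is split by sign, the two halves are joined in `GemmThetaLawGenMixC.lean`). [cell]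
-/

namespace Literature.ComputerArithmetic.FloatingPoint

namespace MiniFloat

namespace ThetaLaw

/-- Level `Q`, sign `+`, of the E3M2×E2M3 law check: all classes pass and cover (2395 of the
level's 4790 classes, all 481 letters). [cell, kernel `decide`] -/
theorem levCheck_e3m2e2m3_Q_pos :
    (e3m2e2m3Law.lam.all fun q =>
      (e3m2e2m3Law.mainClasses Lev.Q 1 q).all e3m2e2m3Law.clsOK &&
        e3m2e2m3Law.coverOK Lev.Q 1 q) = true := by
  decide +kernel

/-- Level `Q`, sign `−`, of the E3M2×E2M3 law check: all classes pass and cover (2395 of the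
level's 4790 classes, all 481 letters). [cell, kernel `decide`] -/
theorem levCheck_e3m2e2m3_Q_neg :
    (e3m2e2m3Law.lam.all fun q =>
      (e3m2e2m3Law.mainClasses Lev.Q (-1) q).all e3m2e2m3Law.clsOK &&
        e3m2e2m3Law.coverOK Lev.Q (-1) q) = true := by
  decide +kernel

end ThetaLaw

end MiniFloat

end Literature.ComputerArithmetic.FloatingPoint
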